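import Summits.ABC.ABC.Theorems.DefiniteXiXiBoundUpgrade
import Summits.ABC.ABC.Theorems.DefiniteXiXiStrongBoundAllTamExp
import Summits.ABC.ABC.Theorems.AbcValuationProduct
import HarnessLib

/-!
# Crux `XiStrongBound` (stmt-ABC-11337), line SplitProof — calibration of the reshaped split

The line's skeleton v3 (`Cruxes/XiStrongBound/Lines/SplitProof.lean`) proves the crux
`XiStrongBound` (`ξ(E_{a,b}; N/N⁻, N⁻) · ∏_{q ∣ N⁻} v_q(Δ_min) ≤ C_ε N^{2+ε}`) from the route's rev-12 binders
`EisensteinQuarantine` (stmt-ABC-15023: `ordProj[2] ξ · ordProj[3] ξ ≤ C_ε N^ε ∏_{q ∣ N, q ∤ N⁻} v_q(Δ_min)`) and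
`SteinbergCore` (stmt-ABC-15024: `(ξ / (ordProj[2] ξ · ordProj[3] ξ)) · ∏_{q ∣ N} v_q(Δ_min) ≤ C_ε N^{2+ε}`) through
the landed algebra `DefiniteXiXiBoundUpgrade.xiStrongBound_of_eisensteinQuarantine_of_steinbergCore`.
This file records, with complete proofs, how that reshape sits relative to the previously registered stub set
(skeleton 307a9577: the `∃B`-form quarantine with allowance `(∏_{q ∣ N} v_q)^B`, the irreducible core with the
product over `q ∣ N⁻` only, and the Frey allowance `∏_{q ∣ N} v_q ≤ C_ε N^ε` obtained from
`AbcValuationProduct` in `DefiniteXiXiStrongBoundAllTamExp.lean`, p87956; the milestone, formerly the route item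
`Summit.ABC.ABC.Theses.RibetTakahashiSplit.AbcValuationProduct`, stmt-ABC-1567, is since 2026-08-16 the
`@[conjecture]` decl `Summit.ABC.ABC.Theorems.AbcValuationProduct` of `Theorems/AbcValuationProduct.lean`,
statement verbatim, and is referenced from there):

* `oldEisensteinQuarantine_of_eisensteinQuarantine` — the route binder implies the old `∃B`-form stub with
  `B = 1`: `∏_{q ∣ N, q ∤ N⁻} v_q ≤ ∏_{q ∣ N} v_q` because every `v_q(Δ_min)`, `q ∣ N⁻ ∣ N`, is `≥ 1`
  (`one_le_factorization_minimalDiscriminantNorm_freyCurve`: conductor and minimal discriminant have the same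
  prime factors).
* `oldIrreducibleCore_of_steinbergCore` — the route binder implies the old irreducible-core stub:
  `∏_{q ∣ N⁻} v_q ≤ ∏_{q ∣ N} v_q` for the same reason.
* `steinbergCore_of_xiStrongBound_of_allTamExp`, `steinbergCore_of_valuationProduct_of_xiStrongBound`
  (deprecated alias `steinbergCore_of_abcValuationProduct_of_xiStrongBound`) — the
  CONVERSE: the crux together with the Frey allowance `∏_{q ∣ N} v_q(Δ_min) ≤ C_ε N^ε` (in particular together with
  `AbcValuationProduct`, by p87956) gives `SteinbergCore` (`ξ/s ≤ ξ ≤ ξ · ∏_{q ∣ N⁻} v_q`, the product being `≥ 1`).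
* `xiStrongBound_iff_steinbergCore_of_valuationProduct` (deprecated alias `xiStrongBound_iff_steinbergCore`) — hence,
  GIVEN the abc-free binder `EisensteinQuarantine` and the sub-abc milestone `AbcValuationProduct`, the crux and
  `SteinbergCore` are EQUIVALENT: the reshape removes the open dependency `AbcValuationProduct` from the
  composition and loses nothing, and `SteinbergCore` is certified crux-strength (abc-strength) modulo those two
  statements.
No new definitions; no named-fact hypotheses other than the route decls themselves.
-/

-- `Summit.<Summit>.<Problem>` is the mandated summit-side namespace (CONVENTIONS §2); for the single-conjunct summit `ABC` the two coincide, so the duplicate `ABC.ABC` is deliberate.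
set_option linter.dupNamespace false

noncomputable section

namespace Summit.ABC.ABC.Theorems.DefiniteXiXiStrongBoundSplit

open Literature.NumberTheory.EllipticCurves Literature.NumberTheory.Automorphic
open Summit.ABC.ABC.Theses.DefiniteXi
open Summit.ABC.ABC.Theorems.DefiniteXiXiBoundUpgrade

/-! ## The new stubs imply the old registered stubs -/

/-- On the domain of the cruxes (`N⁻ ∣ N`, `N` the conductor of `E_{a,b}`), the complementary exponent product
is at most the full one: `∏_{q ∣ N, q ∤ N⁻} v_q(Δ_min) ≤ ∏_{q ∣ N} v_q(Δ_min)`, because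
`∏_{q ∣ N} = ∏_{q ∣ N, q ∤ N⁻} · ∏_{q ∣ N⁻}` (`Finset.prod_sdiff`) and each `v_q(Δ_min)`, `q ∣ N⁻`, is `≥ 1`
(`one_le_factorization_minimalDiscriminantNorm_freyCurve`). [folklore] -/
theorem prod_sdiff_factorization_le_prod {a b : ℤ} (h0 : a * b * (a + b) ≠ 0) {N : ℕ} [NeZero N]
    (hN : (freyCurve a b).conductorNorm ℤ = N) {Nm : ℕ} (hNm : Nm ∣ N) :
    ∏ q ∈ N.primeFactors \ Nm.primeFactors, ((freyCurve a b).minimalDiscriminantNorm ℤ).factorization q ≤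
      ∏ q ∈ N.primeFactors, ((freyCurve a b).minimalDiscriminantNorm ℤ).factorization q := by
  have hsub : Nm.primeFactors ⊆ N.primeFactors := Nat.primeFactors_mono hNm (NeZero.ne N)
  rw [← Finset.prod_sdiff hsub]
  refine Nat.le_mul_of_pos_right _ (Finset.prod_pos fun q hq => ?_)
  exact one_le_factorization_minimalDiscriminantNorm_freyCurve h0 hN hNm hq

/-- On the domain of the cruxes, the quarantined exponent product is at most the full one:
`∏_{q ∣ N⁻} v_q(Δ_min) ≤ ∏_{q ∣ N} v_q(Δ_min)` (`N⁻ ∣ N`; the omitted factors `v_q`, `q ∣ N`, are `≥ 1`). [folklore] -/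
theorem prod_factorization_le_prod {a b : ℤ} (h0 : a * b * (a + b) ≠ 0) {N : ℕ} [NeZero N]
    (hN : (freyCurve a b).conductorNorm ℤ = N) {Nm : ℕ} (hNm : Nm ∣ N) :
    ∏ q ∈ Nm.primeFactors, ((freyCurve a b).minimalDiscriminantNorm ℤ).factorization q ≤
      ∏ q ∈ N.primeFactors, ((freyCurve a b).minimalDiscriminantNorm ℤ).factorization q := by
  have hsub : Nm.primeFactors ⊆ N.primeFactors := Nat.primeFactors_mono hNm (NeZero.ne N)
  refine Finset.prod_le_prod_of_subset_of_one_le' hsub fun q hq _ => ?_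
  exact one_le_factorization_minimalDiscriminantNorm_freyCurve h0 hN (dvd_refl N) hq

/-- **The route binder `EisensteinQuarantine` implies the old `∃B`-form quarantine stub of skeleton 307a9577**
(registered signature, verbatim), with `B = 1`: `ordProj[2] ξ · ordProj[3] ξ = 2^{v₂ξ} · 3^{v₃ξ}` by definition
of `ordProj`, the allowance `∏_{q ∣ N, q ∤ N⁻} v_q` is `≤ ∏_{q ∣ N} v_q` (`prod_sdiff_factorization_le_prod`), and
the constant is replaced by `max C 0 ≥ 0`. [folklore] -/
theorem oldEisensteinQuarantine_of_eisensteinQuarantine (h : EisensteinQuarantine) :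
    ∃ B : ℝ, 0 ≤ B ∧ ∀ ε : ℝ, 0 < ε → ∃ C : ℝ, ∀ a b : ℤ, IsCoprime a b → a * b * (a + b) ≠ 0 →
      ∀ (N : ℕ) [NeZero N], (freyCurve a b).conductorNorm ℤ = N →
      ∀ Nm : ℕ, Odd Nm → Squarefree Nm → Odd Nm.primeFactors.card → Nm ∣ N →
        ((2 ^ (brandtXi (N / Nm) Nm (fun n => (freyCurve a b).LFunction n)).factorization 2 *
              3 ^ (brandtXi (N / Nm) Nm (fun n => (freyCurve a b).LFunction n)).factorization 3 : ℕ) : ℝ) ≤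
          C * (N : ℝ) ^ ε *
            ((∏ q ∈ N.primeFactors, ((freyCurve a b).minimalDiscriminantNorm ℤ).factorization q : ℕ) : ℝ) ^ B := by
  refine ⟨1, zero_le_one, fun ε hε => ?_⟩
  obtain ⟨C, hC⟩ := h ε hε
  refine ⟨max C 0, fun a b hab h0 N _ hN Nm hodd hsq hcard hdvd => ?_⟩
  have key := hC a b hab h0 N hN Nm hodd hsq hcard hdvd
  have hNpos : (0 : ℝ) < (N : ℝ) := by exact_mod_cast Nat.pos_of_ne_zero (NeZero.ne N)
  have hle : ((∏ q ∈ N.primeFactors \ Nm.primeFactors,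
      ((freyCurve a b).minimalDiscriminantNorm ℤ).factorization q : ℕ) : ℝ) ≤
      ((∏ q ∈ N.primeFactors, ((freyCurve a b).minimalDiscriminantNorm ℤ).factorization q : ℕ) : ℝ) := by
    exact_mod_cast prod_sdiff_factorization_le_prod h0 hN hdvd
  rw [Real.rpow_one]
  calc ((2 ^ (brandtXi (N / Nm) Nm (fun n => (freyCurve a b).LFunction n)).factorization 2 *
          3 ^ (brandtXi (N / Nm) Nm (fun n => (freyCurve a b).LFunction n)).factorization 3 : ℕ) : ℝ)
      ≤ C * (N : ℝ) ^ ε * ((∏ q ∈ N.primeFactors \ Nm.primeFactors,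
          ((freyCurve a b).minimalDiscriminantNorm ℤ).factorization q : ℕ) : ℝ) := key
    _ ≤ max C 0 * (N : ℝ) ^ ε * ((∏ q ∈ N.primeFactors \ Nm.primeFactors,
          ((freyCurve a b).minimalDiscriminantNorm ℤ).factorization q : ℕ) : ℝ) := by
        gcongr
        exact le_max_left _ _
    _ ≤ max C 0 * (N : ℝ) ^ ε *
          ((∏ q ∈ N.primeFactors, ((freyCurve a b).minimalDiscriminantNorm ℤ).factorization q : ℕ) : ℝ) := by
        gcongr

/-- **The route binder `SteinbergCore` implies the old irreducible-core stub of skeleton 307a9577**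
(registered signature, verbatim): the product over `q ∣ N⁻` is at most the product over `q ∣ N`
(`prod_factorization_le_prod`), and `ordProj[2] ξ · ordProj[3] ξ = 2^{v₂ξ} · 3^{v₃ξ}` by definition. [folklore] -/
theorem oldIrreducibleCore_of_steinbergCore (h : SteinbergCore) :
    ∀ ε : ℝ, 0 < ε → ∃ C : ℝ, ∀ a b : ℤ, IsCoprime a b → a * b * (a + b) ≠ 0 →
      ∀ (N : ℕ) [NeZero N], (freyCurve a b).conductorNorm ℤ = N →
      ∀ Nm : ℕ, Odd Nm → Squarefree Nm → Odd Nm.primeFactors.card → Nm ∣ N →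
        ((brandtXi (N / Nm) Nm (fun n => (freyCurve a b).LFunction n) /
                (2 ^ (brandtXi (N / Nm) Nm (fun n => (freyCurve a b).LFunction n)).factorization 2 *
                  3 ^ (brandtXi (N / Nm) Nm (fun n => (freyCurve a b).LFunction n)).factorization 3) : ℕ) : ℝ) *
            ((∏ q ∈ Nm.primeFactors, ((freyCurve a b).minimalDiscriminantNorm ℤ).factorization q : ℕ) : ℝ) ≤
          C * (N : ℝ) ^ (2 + ε) := by
  intro ε hε
  obtain ⟨C, hC⟩ := h ε hε
  refine ⟨C, fun a b hab h0 N _ hN Nm hodd hsq hcard hdvd => ?_⟩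
  have key := hC a b hab h0 N hN Nm hodd hsq hcard hdvd
  refine le_trans ?_ key
  have hle : ((∏ q ∈ Nm.primeFactors, ((freyCurve a b).minimalDiscriminantNorm ℤ).factorization q : ℕ) : ℝ) ≤
      ((∏ q ∈ N.primeFactors, ((freyCurve a b).minimalDiscriminantNorm ℤ).factorization q : ℕ) : ℝ) := by
    exact_mod_cast prod_factorization_le_prod h0 hN hdvd
  exact mul_le_mul_of_nonneg_left hle (Nat.cast_nonneg _)

/-! ## The converse: `SteinbergCore` from the crux and the Frey allowance -/

/-- **`SteinbergCore` from the crux and the Frey allowance `∏_{q ∣ N} v_q(Δ_min) ≤ C_ε N^ε`**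
(the allowance is verbatim the conclusion of `stub_allTamExp_of_valuationProduct`, p87956): at `ε/2` each,
`ξ/s ≤ ξ ≤ ξ · ∏_{q ∣ N⁻} v_q ≤ C₁ N^{2+ε/2}` (the product is `≥ 1`,
`one_le_prod_factorization_minimalDiscriminantNorm_freyCurve`) and `∏_{q ∣ N} v_q ≤ C₂ N^{ε/2}`. [folklore] -/
theorem steinbergCore_of_xiStrongBound_of_allTamExp
    (hT : ∀ ε : ℝ, 0 < ε → ∃ C : ℝ, ∀ a b : ℤ, IsCoprime a b → a * b * (a + b) ≠ 0 →
      ∀ (N : ℕ) [NeZero N], (freyCurve a b).conductorNorm ℤ = N →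
        ((∏ q ∈ N.primeFactors, ((freyCurve a b).minimalDiscriminantNorm ℤ).factorization q : ℕ) : ℝ) ≤
          C * (N : ℝ) ^ ε)
    (h : XiStrongBound) : SteinbergCore := by
  intro ε hε
  obtain ⟨C₁, hC₁⟩ := h (ε / 2) (by linarith)
  obtain ⟨C₂, hC₂⟩ := hT (ε / 2) (by linarith)
  refine ⟨max C₁ 0 * max C₂ 0, fun a b hab h0 N _ hN Nm hodd hsq hcard hdvd => ?_⟩
  have h1 := hC₁ a b hab h0 N hN Nm hodd hsq hcard hdvd
  have h2 := hC₂ a b hab h0 N hN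
  set ξ : ℕ := brandtXi (N / Nm) Nm (fun n => (freyCurve a b).LFunction n) with hξ
  set v : ℕ → ℕ := fun q => ((freyCurve a b).minimalDiscriminantNorm ℤ).factorization q with hv
  have hNpos : (0 : ℝ) < (N : ℝ) := by exact_mod_cast Nat.pos_of_ne_zero (NeZero.ne N)
  have hprod1 : (1 : ℝ) ≤ ∏ q ∈ Nm.primeFactors, ((v q : ℕ) : ℝ) :=
    one_le_prod_factorization_minimalDiscriminantNorm_freyCurve h0 hN hdvd
  -- `ξ / s ≤ ξ ≤ ξ · ∏_{q ∣ N⁻} v_q ≤ max C₁ 0 · N^{2+ε/2}`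
  have hξle : ((ξ / (ordProj[2] ξ * ordProj[3] ξ) : ℕ) : ℝ) ≤ max C₁ 0 * (N : ℝ) ^ (2 + ε / 2) := by
    have hdiv : ((ξ / (ordProj[2] ξ * ordProj[3] ξ) : ℕ) : ℝ) ≤ (ξ : ℝ) := by
      exact_mod_cast Nat.div_le_self _ _
    calc ((ξ / (ordProj[2] ξ * ordProj[3] ξ) : ℕ) : ℝ) ≤ (ξ : ℝ) := hdiv
      _ ≤ (ξ : ℝ) * ∏ q ∈ Nm.primeFactors, ((v q : ℕ) : ℝ) :=
          le_mul_of_one_le_right (Nat.cast_nonneg _) hprod1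
      _ ≤ C₁ * (N : ℝ) ^ (2 + ε / 2) := h1
      _ ≤ max C₁ 0 * (N : ℝ) ^ (2 + ε / 2) :=
          mul_le_mul_of_nonneg_right (le_max_left _ _) (Real.rpow_nonneg hNpos.le _)
  -- `∏_{q ∣ N} v_q ≤ max C₂ 0 · N^{ε/2}`
  have hTle : ((∏ q ∈ N.primeFactors, v q : ℕ) : ℝ) ≤ max C₂ 0 * (N : ℝ) ^ (ε / 2) :=
    h2.trans (mul_le_mul_of_nonneg_right (le_max_left _ _) (Real.rpow_nonneg hNpos.le _))
  have hNsplit : (N : ℝ) ^ (2 + ε / 2) * (N : ℝ) ^ (ε / 2) = (N : ℝ) ^ (2 + ε) := by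
    rw [← Real.rpow_add hNpos]; ring_nf
  calc ((ξ / (ordProj[2] ξ * ordProj[3] ξ) : ℕ) : ℝ) * ((∏ q ∈ N.primeFactors, v q : ℕ) : ℝ)
      ≤ (max C₁ 0 * (N : ℝ) ^ (2 + ε / 2)) * (max C₂ 0 * (N : ℝ) ^ (ε / 2)) :=
        mul_le_mul hξle hTle (Nat.cast_nonneg _) (by positivity)
    _ = max C₁ 0 * max C₂ 0 * ((N : ℝ) ^ (2 + ε / 2) * (N : ℝ) ^ (ε / 2)) := by ring
    _ = max C₁ 0 * max C₂ 0 * (N : ℝ) ^ (2 + ε) := by rw [hNsplit]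

/-- **`SteinbergCore` from the crux and the abc valuation-product milestone**
(`Summit.ABC.ABC.Theorems.AbcValuationProduct`, the open obligation re-homed in `Theorems/AbcValuationProduct.lean`;
formerly the route item `RibetTakahashiSplit.AbcValuationProduct`, stmt-ABC-1567, sub-abc): the milestone gives the
Frey allowance (`stub_allTamExp_of_valuationProduct`, p87956), and `steinbergCore_of_xiStrongBound_of_allTamExp`
applies. [folklore] -/
theorem steinbergCore_of_valuationProduct_of_xiStrongBound :
    Summit.ABC.ABC.Theorems.AbcValuationProduct →
      Summit.ABC.ABC.Theses.DefiniteXi.XiStrongBound → Summit.ABC.ABC.Theses.DefiniteXi.SteinbergCore :=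
  fun hAVP h => steinbergCore_of_xiStrongBound_of_allTamExp (stub_allTamExp_of_valuationProduct hAVP) h

/-- Deprecated spelling of `steinbergCore_of_valuationProduct_of_xiStrongBound`: the original statement took the
route decl `Summit.ABC.ABC.Theses.RibetTakahashiSplit.AbcValuationProduct` (stmt-ABC-1567) as hypothesis; that decl
was dropped from the gate-generated thesis module on 2026-08-16 and re-homed, statement verbatim, as the
`@[conjecture]` decl `Summit.ABC.ABC.Theorems.AbcValuationProduct`, which the new spelling takes instead
(definitionally the same statement). [folklore] -/
@[deprecated steinbergCore_of_valuationProduct_of_xiStrongBound (since := "2026-08-16")]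
alias steinbergCore_of_abcValuationProduct_of_xiStrongBound := steinbergCore_of_valuationProduct_of_xiStrongBound

/-- **Calibration of the split.** Given the abc-FREE binder `EisensteinQuarantine` (stmt-ABC-15023) and the
sub-abc milestone `AbcValuationProduct` (stmt-ABC-1567), the crux `XiStrongBound` (stmt-ABC-11337) and the
abc-strength binder `SteinbergCore` (stmt-ABC-15024) are EQUIVALENT
(`xiStrongBound_of_eisensteinQuarantine_of_steinbergCore` one way, the converse above the other). [folklore] -/
theorem xiStrongBound_iff_steinbergCore_of_valuationProduct (hEis : EisensteinQuarantine)
    (hAVP : Summit.ABC.ABC.Theorems.AbcValuationProduct) :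
    XiStrongBound ↔ SteinbergCore :=
  ⟨steinbergCore_of_valuationProduct_of_xiStrongBound hAVP,
    xiStrongBound_of_eisensteinQuarantine_of_steinbergCore hEis⟩

/-- Deprecated spelling of `xiStrongBound_iff_steinbergCore_of_valuationProduct`: the original statement took the
route decl `Summit.ABC.ABC.Theses.RibetTakahashiSplit.AbcValuationProduct` (stmt-ABC-1567) as the hypothesis `hAVP`;
that decl was dropped from the gate-generated thesis module on 2026-08-16 and re-homed, statement verbatim, as the
`@[conjecture]` decl `Summit.ABC.ABC.Theorems.AbcValuationProduct` (definitionally the same statement). [folklore] -/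
@[deprecated xiStrongBound_iff_steinbergCore_of_valuationProduct (since := "2026-08-16")]
alias xiStrongBound_iff_steinbergCore := xiStrongBound_iff_steinbergCore_of_valuationProduct

end Summit.ABC.ABC.Theorems.DefiniteXiXiStrongBoundSplit

end
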